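import Mathlib.Topology.Algebra.UniformRing
import Summits.ABC.IUTFork.Joshi.ArithHolStructureTiltCardinality
import Summits.ABC.IUTFork.Joshi.UntiltGaussTilt
import HarnessLib

/-!
# The Gauss untilt AGAINST THE TILT (2/2): `𝔾` carries a TYPED arithmetic holomorphic structure over `ℂ_p^♭` — a calibration of
# the typed tilting datum of [J-I] Def. 4.1.1 (1); `NeedNotBeTopIso` / `ExistsNonIso X A (tilt ℂ_p)` inhabited AS TYPED

Construction-and-proof sequel (abc-iut cell, block E, rung LADDER-ABC:A2.E; seat abc-iut-E-t55 g4) of `Joshi/UntiltGaussTilt.lean`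
(part 1/2: `𝔾 := Untilt.gaussIrr p` is NOT an untilt of `ℂ_p^♭` — `isEmpty_tiltMonoidDatum_gaussIrr_padicTilt`,
`range_norm_gaussIrr_ne_padicComplex`; `𝔠 ≤ #K♭`, Steinitz for tilts — `nonempty_ringEquiv_tilt`; `#ℂ_p = #𝔾 = 𝔠`) and of
E-t10's `Joshi/ArithHolStructureTiltCardinality.lean` (`TiltModel.mk_tilt_eq : #K♭ = #K`, `ArithHolStructure.sameCardinality`,
`sameValueGroup_of_tiltIso_isometry`), over abc-iut-E-t10's `ArithHolStructure` (p431050/p437040: [J-I] Def. 4.1.1 with the tilt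
typed CONCRETELY — `tiltIso : ATS1.tilt U ≃+* F`, `sharp : F →*₀ K` isometric; claim-defs `SameValueGroup`, `SameCardinality`, `NeedNotBeTopIso`,
`ExistsNonIso`, `existsNonIso_of_needNotBeTopIso`), E-t10's tilt toolkit (`TiltModel.normedFieldTilt`, `tiltMonoidDatum`,
`sharpHom`, `completeSpace_tilt`, `isUltrametricDist_tilt`, `isAlgClosed_normedFieldTilt`, `charP_normedFieldTilt`, `ofTilt`;
p433682…p453124), E-t1's carriers (`Untilt`, `TopIso`, `ATSObj.embPadicComplex`, p428170) and my p447273/p448902 (`algClGauss`,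
`norm_algClGauss`, `Untilt.not_topIso_padicComplex_gaussIrr`). BY NAME; nothing restated or edited; no `Prop` claim, no fact, no
instance, no sorry. TAKES NO SIDE on [IUTchIII] Cor. 3.12 or on any author; typed ≠ proved ≠ endorsed.

SOURCE (K. Joshi, arXiv 2106.11452 **v4**, UNREFEREED; typed AS A CANDIDATE, D-0012; cell render): §3.5 p.9 l.38–40 «by an untilt
of F, I will mean a perfectoid field K, of characteristic zero, with K♭ isometric with F»; §3.6 p.10 l.10–13 «Without further
mention, all untilts K will be assumed to be of this type»; Def. 4.1.1 p.18 l.11–22 «(1) a choice of an untilt (K ⊃ E, K♭ ≃ F) for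
some algebraically closed, perfectoid field F of characteristic p > 0»; Prop. 4.1.7 p.19 l.22–43 «(1) … the same cardinality, the
same residue fields and the same value groups as that of F. (2) There exist arithmetic holomorphic structures … which are not
isomorphic. Furthermore, if F = ℂ_p^♭, then K₁, K₂ need not even be topologically isomorphic».

WHAT IS CONSTRUCTED / PROVED (p431050 reading note (e) and merge-debt M-t10-1 — «agreement of `sharp` with `PreTilt.untilt ∘ ι⁻¹`
NOT stated» — turned into a kernel witness):
* `padicToGauss : ℂ_p →+* 𝔾` — the completion-extension (Mathlib `UniformSpace.Completion.extensionHom`) of the isometric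
  `algClGauss : Q̄_p ↪ 𝔾`; ISOMETRIC (`norm_padicToGauss`) and continuous; `embGauss : E ↪ ℂ_p ↪ 𝔾`. [folklore]
* `TiltCalibration.nonempty_ringEquiv_tilt_iff` — **`K♭ ≃+* V♭` abstractly IFF `#K = #V`** (part 1's Steinitz lemma sharpened by
  E-t10's `#K♭ = #K`, `ArithHolStructureTiltCardinality.lean`): the typed slot `tiltIso` records equinumerosity and nothing else.
* **`TiltCalibration.ofIsometricEmbedding`**: AS TYPED, an untilt `W` receiving an EQUINUMEROUS untilt `V` ISOMETRICALLY carries an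
  `ArithHolStructure X A (tilt V)` for every base point — `tiltIso : W♭ ≃+* V♭` the ABSTRACT Steinitz isomorphism, `sharp := (V ↪ W)
  ∘ ♯_V` multiplicative and isometric INTO `W` (E-t10's `tiltMonoidDatum V`); its `SameValueGroup` holds IFF `W` and `V` have the
  same value set (`sameValueGroup_ofIsometricEmbedding_iff`); its `SameCardinality` holds (E-t10's `sameCardinality`, every `S`); if
  the value sets differ its `tiltIso` is NOT an isometry (E-t10's `sameValueGroup_of_tiltIso_isometry`, contraposed).
* At `V = ℂ_p`, `W = 𝔾`: **`gaussIrrOverPadicTilt`** — `𝔾` over `ℂ_p^♭` AS TYPED; **`not_sameValueGroup_gaussIrrOverPadicTilt`**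
  (Prop. 4.1.7 (1) «same value groups as that of F» FAILS there) while `sameCardinality_gaussIrrOverPadicTilt` holds and
  `not_isometry_tiltIso_gaussIrrOverPadicTilt` (its `tiltIso` is no isometry — none exists, part 1);
  `exists_arithHolStructure_without_tiltMonoidDatum` (a typed structure whose untilt admits NO tilt-monoid datum over `F`);
  `not_forall_sameValueGroup_padicTilt`; and, modulo base points for `ℂ_p` and `𝔾`, **`needNotBeTopIso_padicTilt`** /
  **`existsNonIso_padicTilt`**: E-t10's claim-defs `NeedNotBeTopIso X A (tilt ℂ_p)` / `ExistsNonIso X A (tilt ℂ_p)` (Prop. 4.1.7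
  (2)) are INHABITED AS TYPED — by `ℂ_p` over `ℂ_p^♭` (E-t10's `ofTilt`) and `𝔾` over `ℂ_p^♭`, `¬ ℂ_p.TopIso 𝔾` (p448902).
READING (located, not adjudicated): the inhabitation is for a NON-[KedlayaTemkin2018] reason — `𝔾` is not an untilt of `ℂ_p^♭`
(part 1) — so it CALIBRATES THE TYPING: p431050's tilt datum (abstract `tiltIso` + isometric-INTO `sharp`) does not say «K is an
untilt of F» (print §3.5/§3.6); E-t10's ONTO `TiltMonoidDatum` (under which `SameValueGroup` is a theorem, p433682, and which `𝔾`
does not admit, part 1) is exactly the repair. Nothing here bears on the preprint's Prop. 4.1.7, whose `K₁, K₂` ARE untilts of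
`F`. All statements modulo ABSTRACT base points (`A.BasePt` hypotheses, exactly as E-t10's `ofTilt`). bears_on: LADDER-ABC:A2.E.
-/

noncomputable section

open Cardinal Filter Topology
open scoped NNReal

namespace Summit.ABC.IUTFork.Joshi

open ATS1 ATS1.TiltModel ATS1.ArithHolStructure Literature.AnabelianGeometry.SemiGraphs

variable (p : ℕ) [Fact p.Prime]

/-! ## §0' Steinitz for tilts, sharpened by E-t10's `#K♭ = #K` (`TiltModel.mk_tilt_eq`) -/

namespace TiltCalibration

variable {p}

/-- **Two EQUINUMEROUS untilts have abstractly isomorphic tilts** — part 1's `nonempty_ringEquiv_tilt` with the hypothesis `≤ 𝔠`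
replaced by `#U = #V`, thanks to E-t10's unconditional `#K♭ = #K` (`TiltModel.mk_tilt_eq`) and part 1's `𝔠 ≤ #K♭`
(`continuum_le_mk_tilt`, uncountability for Steinitz). [folklore] -/
theorem nonempty_ringEquiv_tilt_of_mk_eq (U V : Untilt p) (h : #U.K = #V.K) : Nonempty (tilt U ≃+* tilt V) := by
  haveI := isAlgClosed_tilt U
  haveI := isAlgClosed_tilt V
  haveI := charP_tilt U
  haveI := charP_tilt V
  refine IsAlgClosed.ringEquiv_of_equiv_of_char_eq p ?_ (Cardinal.eq.1 (by rw [mk_tilt_eq U, mk_tilt_eq V, h]))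
  exact aleph0_lt_continuum.trans_le (continuum_le_mk_tilt U)

/-- **The typed slot `tiltIso : K♭ ≃+* F` at `F := V♭` is inhabited IFF `#K = #V`**: abstract isomorphy of tilts is EXACTLY
equinumerosity of the untilts (Steinitz one way, `mk_tilt_eq` the other). [folklore] -/
theorem nonempty_ringEquiv_tilt_iff (U V : Untilt p) : Nonempty (tilt U ≃+* tilt V) ↔ #U.K = #V.K :=
  ⟨fun ⟨e⟩ => by rw [← mk_tilt_eq U, ← mk_tilt_eq V]; exact mk_congr e.toEquiv, nonempty_ringEquiv_tilt_of_mk_eq U V⟩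

/-- Every untilt has cardinality `≥ 𝔠` (part 1's `continuum_le_mk_tilt` through `mk_tilt_eq`). [folklore] -/
theorem continuum_le_mk (U : Untilt p) : 𝔠 ≤ #U.K := (continuum_le_mk_tilt U).trans_eq (mk_tilt_eq U)

end TiltCalibration

namespace GaussUntilt

open TiltCalibration

/-! ## §2 Calibration of the typed Def. 4.1.1 (1): `𝔾` over `ℂ_p^♭` AS TYPED -/

section Embedding

variable (r : ℝ) (hr : 0 < r)

/-- `Q̄_p ↪ 𝔾` (p447273 `algClGauss`) retyped on E-t1's carrier `(Untilt.gauss p r hr).K` (same term; keeps every instance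
path below on the `Untilt` side). [folklore] -/
def algClGaussU : PadicAlgCl p →+* (Untilt.gauss p r hr).K := algClGauss p r hr

/-- … isometric (p447273 `norm_algClGauss`). [folklore] -/
theorem norm_algClGaussU (x : PadicAlgCl p) : ‖algClGaussU p r hr x‖ = ‖x‖ := norm_algClGauss p r hr x

/-- … continuous (p447273 `continuous_algClGauss`). [folklore] -/
theorem continuous_algClGaussU : Continuous (algClGaussU p r hr) := continuous_algClGauss p r hr

/-- **`ℂ_p ↪ 𝔾`**: the extension to the completion `ℂ_p = \widehat{Q̄_p}` of the isometric, continuous `algClGauss : Q̄_p ↪ 𝔾`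
(p447273), Mathlib `UniformSpace.Completion.extensionHom`; on E-t1's carriers `(Untilt.padicComplex p).K → (Untilt.gauss p r hr).K`.
[folklore] -/
def padicToGauss : (Untilt.padicComplex p).K →+* (Untilt.gauss p r hr).K :=
  UniformSpace.Completion.extensionHom (algClGaussU p r hr) (continuous_algClGaussU p r hr)

/-- On `Q̄_p` it is `algClGauss`. [folklore] -/
theorem padicToGauss_coe (x : PadicAlgCl p) : padicToGauss p r hr (x : ℂ_[p]) = algClGaussU p r hr x :=
  UniformSpace.Completion.extensionHom_coe _ _ x

/-- Unfolding: the underlying map is the completion extension. [folklore] -/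
theorem coe_padicToGauss :
    ⇑(padicToGauss p r hr) = UniformSpace.Completion.extension (fun x : PadicAlgCl p => algClGaussU p r hr x) := rfl

/-- `ℂ_p ↪ 𝔾` is continuous. [folklore] -/
theorem continuous_padicToGauss : Continuous (padicToGauss p r hr) := by
  rw [coe_padicToGauss]
  exact UniformSpace.Completion.continuous_extension

/-- **`ℂ_p ↪ 𝔾` is ISOMETRIC** (closed condition, true on the dense `Q̄_p` by `norm_algClGauss`). [folklore] -/
theorem norm_padicToGauss (x : (Untilt.padicComplex p).K) : ‖padicToGauss p r hr x‖ = ‖x‖ := by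
  refine UniformSpace.Completion.induction_on (α := PadicAlgCl p)
    (p := fun x : (Untilt.padicComplex p).K => ‖padicToGauss p r hr x‖ = ‖x‖) x ?_ ?_
  · exact isClosed_eq (continuous_norm.comp (continuous_padicToGauss p r hr)) continuous_norm
  · intro a
    show ‖padicToGauss p r hr (a : ℂ_[p])‖ = ‖(a : ℂ_[p])‖
    rw [padicToGauss_coe, norm_algClGaussU]
    exact (PadicComplex.norm_extends p a).symm

/-- `E ↪ 𝔾` through `ℂ_p` (E-t1's `ATSObj.embPadicComplex`, then `padicToGauss`). [folklore] -/
def embGauss (X : TemperedCurve p) : X.K →+* (Untilt.gauss p r hr).K :=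
  (padicToGauss p r hr).comp (ATSObj.embPadicComplex X)

/-- … continuous on `ℚ_p`. [folklore] -/
theorem continuous_embGauss (X : TemperedCurve p) :
    Continuous fun x : ℚ_[p] => embGauss p r hr X (algebraMap ℚ_[p] X.K x) :=
  (continuous_padicToGauss p r hr).comp (ATSObj.continuous_embPadicComplex X)

end Embedding

/-- `ℂ_p ↪ 𝔾 = Untilt.gaussIrr p` (radius `p^√2`). [folklore] -/
def padicToGaussIrr : (Untilt.padicComplex p).K →+* (Untilt.gaussIrr p).K :=
  padicToGauss p ((p : ℝ) ^ Real.sqrt 2) (rpow_sqrt_two_pos p)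

/-- … isometric. [folklore] -/
theorem norm_padicToGaussIrr (x : (Untilt.padicComplex p).K) : ‖padicToGaussIrr p x‖ = ‖x‖ :=
  norm_padicToGauss p _ _ x

/-- `E ↪ 𝔾 = Untilt.gaussIrr p`. [folklore] -/
def embGaussIrr (X : TemperedCurve p) : X.K →+* (Untilt.gaussIrr p).K :=
  embGauss p ((p : ℝ) ^ Real.sqrt 2) (rpow_sqrt_two_pos p) X

/-- … continuous on `ℚ_p`. [folklore] -/
theorem continuous_embGaussIrr (X : TemperedCurve p) :
    Continuous fun x : ℚ_[p] => embGaussIrr p X (algebraMap ℚ_[p] X.K x) :=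
  continuous_embGauss p _ _ X

end GaussUntilt

namespace TiltCalibration

variable {p}
variable {X : TemperedCurve p} {A : BerkovichDatum X}

/-- **THE TYPED Def. 4.1.1 (1) OVER `V♭`, FOR ANY UNTILT `W` RECEIVING `V` ISOMETRICALLY** (`#W = #V`): all five instance slots
of the tilt base at `F := ATS1.tilt V` are E-t10's hypothesis-free terms (as in `ArithHolStructure.ofTilt`); `tiltIso : W♭ ≃+* V♭` is
the ABSTRACT Steinitz isomorphism (`nonempty_ringEquiv_tilt_of_mk_eq`); `sharp := φ ∘ ♯_V : V♭ → V ↪ W` is multiplicative and ISOMETRIC INTO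
`W` (E-t10's `tiltMonoidDatum V`, then the isometric `φ`). Every field of p431050's structure is supplied AS TYPED — although for
`W ≠` an untilt of `V♭` (e.g. `W = 𝔾`, `V = ℂ_p`, §1) no isometry `W♭ ≅ V♭` exists: the typed datum (p431050 reading note (e),
merge-debt M-t10-1) does not record that `sharp` untilts `tiltIso`. CONSTRUCTED; a calibration of the typing, no claim of Joshi's used
or asserted. [claim: Joshi2021ATS1, status: disputed] -/
def ofIsometricEmbedding (V W : Untilt p) (hVW : #W.K = #V.K) (φ : V.K →+* W.K)
    (hφ : ∀ x, ‖φ x‖ = ‖x‖) (emb : X.K →+* W.K) (h : Continuous fun x : ℚ_[p] => emb (algebraMap ℚ_[p] X.K x))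
    (b : A.BasePt W emb) :
    letI := normedFieldTilt V
    haveI := completeSpace_tilt V
    haveI := isUltrametricDist_tilt V
    haveI := isAlgClosed_normedFieldTilt V
    haveI := charP_normedFieldTilt V
    ArithHolStructure X A (tilt V) :=
  letI := normedFieldTilt V
  haveI := completeSpace_tilt V
  haveI := isUltrametricDist_tilt V
  haveI := isAlgClosed_normedFieldTilt V
  haveI := charP_normedFieldTilt V
  { U := W
    emb := emb
    continuous_emb := h
    tiltIso := Classical.choice (nonempty_ringEquiv_tilt_of_mk_eq W V hVW)
    sharp := φ.toMonoidWithZeroHom.comp (tiltMonoidDatum V).sharpHom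
    norm_sharp := fun y => by
      change ‖φ ((tiltMonoidDatum V).sharpHom y)‖ = _
      rw [hφ]
      exact (tiltMonoidDatum V).norm_sharpHom y
    basePt := b }

/-- Its untilt is `W`. [folklore] -/
theorem ofIsometricEmbedding_U (V W : Untilt p) (hVW : #W.K = #V.K) (φ : V.K →+* W.K)
    (hφ : ∀ x, ‖φ x‖ = ‖x‖) (emb : X.K →+* W.K) (h : Continuous fun x : ℚ_[p] => emb (algebraMap ℚ_[p] X.K x))
    (b : A.BasePt W emb) :
    letI := normedFieldTilt V
    haveI := completeSpace_tilt V
    haveI := isUltrametricDist_tilt V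
    haveI := isAlgClosed_normedFieldTilt V
    haveI := charP_normedFieldTilt V
    (ofIsometricEmbedding V W hVW φ hφ emb h b).U = W := rfl

/-- **`SameValueGroup` of the typed structure holds IFF `W` and `V` have the same value set** (`range_norm_tilt_eq V`): p431050's
claim-def Prop. 4.1.7 (1) «same value groups as that of F», read on `ofIsometricEmbedding`. [folklore] -/
theorem sameValueGroup_ofIsometricEmbedding_iff (V W : Untilt p) (hVW : #W.K = #V.K) (φ : V.K →+* W.K)
    (hφ : ∀ x, ‖φ x‖ = ‖x‖) (emb : X.K →+* W.K) (h : Continuous fun x : ℚ_[p] => emb (algebraMap ℚ_[p] X.K x))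
    (b : A.BasePt W emb) :
    letI := normedFieldTilt V
    haveI := completeSpace_tilt V
    haveI := isUltrametricDist_tilt V
    haveI := isAlgClosed_normedFieldTilt V
    haveI := charP_normedFieldTilt V
    (ofIsometricEmbedding V W hVW φ hφ emb h b).SameValueGroup ↔
      Set.range (fun a : W.K => ‖a‖) = Set.range (fun a : V.K => ‖a‖) := by
  show Set.range (fun a : W.K => ‖a‖) = Set.range (fun y : tilt V => letI := normedFieldTilt V; ‖y‖) ↔ _
  rw [range_norm_tilt_eq V]

/-- **If `W` and `V` have different value sets, the typed `tiltIso : W♭ ≃+* V♭` is NOT an isometry** — by E-t10's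
`sameValueGroup_of_tiltIso_isometry` (an isometric `tiltIso` would give `SameValueGroup`): E-t10's sufficient condition for
Prop. 4.1.7 (1) is exactly what the abstract Steinitz datum lacks. [folklore] -/
theorem not_isometry_tiltIso_ofIsometricEmbedding (V W : Untilt p) (hVW : #W.K = #V.K) (φ : V.K →+* W.K)
    (hφ : ∀ x, ‖φ x‖ = ‖x‖) (emb : X.K →+* W.K) (h : Continuous fun x : ℚ_[p] => emb (algebraMap ℚ_[p] X.K x))
    (b : A.BasePt W emb) (hne : Set.range (fun a : W.K => ‖a‖) ≠ Set.range (fun a : V.K => ‖a‖)) :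
    letI := normedFieldTilt V
    haveI := completeSpace_tilt V
    haveI := isUltrametricDist_tilt V
    haveI := isAlgClosed_normedFieldTilt V
    haveI := charP_normedFieldTilt V
    ¬ ∀ y : tilt W, ‖(ofIsometricEmbedding V W hVW φ hφ emb h b).tiltIso y‖ = (letI := normedFieldTilt W; ‖y‖) :=
  fun hiso =>
  letI := normedFieldTilt V
  haveI := completeSpace_tilt V
  haveI := isUltrametricDist_tilt V
  haveI := isAlgClosed_normedFieldTilt V
  haveI := charP_normedFieldTilt V
  hne ((sameValueGroup_ofIsometricEmbedding_iff V W hVW φ hφ emb h b).1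
    (ArithHolStructure.sameValueGroup_of_tiltIso_isometry _ hiso))

end TiltCalibration

namespace GaussUntilt

open TiltCalibration

variable {p}
variable (X : TemperedCurve p) (A : BerkovichDatum X)

/-- **`𝔾` OVER `ℂ_p^♭`, AS TYPED**: the arithmetic holomorphic structure `(X/E, (𝔾 ⊃ E, 𝔾♭ ≃ ℂ_p♭), ∗_𝔾)` over the tilt base
`F := ATS1.tilt (Untilt.padicComplex p)` with E-t10's instance terms, `tiltIso` abstract (Steinitz, §0), `sharp := (ℂ_p ↪ 𝔾) ∘ ♯`,
`E ↪ 𝔾` through `ℂ_p`; modulo a base point `∗_𝔾` (abstract `A.BasePt`, as in E-t10's `ofTilt`). By §1, `𝔾` is NOT an untilt of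
`ℂ_p^♭`; the typed structure exists all the same. [claim: Joshi2021ATS1, status: disputed] -/
def gaussIrrOverPadicTilt (b : A.BasePt (Untilt.gaussIrr p) (embGaussIrr p X)) :
    letI := normedFieldTilt (Untilt.padicComplex p)
    haveI := completeSpace_tilt (Untilt.padicComplex p)
    haveI := isUltrametricDist_tilt (Untilt.padicComplex p)
    haveI := isAlgClosed_normedFieldTilt (Untilt.padicComplex p)
    haveI := charP_normedFieldTilt (Untilt.padicComplex p)
    ArithHolStructure X A (tilt (Untilt.padicComplex p)) :=
  ofIsometricEmbedding (Untilt.padicComplex p) (Untilt.gaussIrr p) ((mk_gaussIrr p).trans (mk_padicComplex_untilt p).symm)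
    (padicToGaussIrr p) (norm_padicToGaussIrr p) (embGaussIrr p X) (continuous_embGaussIrr p X) b

/-- Its untilt is `𝔾`. [folklore] -/
theorem gaussIrrOverPadicTilt_U (b : A.BasePt (Untilt.gaussIrr p) (embGaussIrr p X)) :
    letI := normedFieldTilt (Untilt.padicComplex p)
    haveI := completeSpace_tilt (Untilt.padicComplex p)
    haveI := isUltrametricDist_tilt (Untilt.padicComplex p)
    haveI := isAlgClosed_normedFieldTilt (Untilt.padicComplex p)
    haveI := charP_normedFieldTilt (Untilt.padicComplex p)
    (gaussIrrOverPadicTilt X A b).U = Untilt.gaussIrr p := rfl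

/-- **Prop. 4.1.7 (1) «the same value groups as that of F» FAILS at `𝔾` over `ℂ_p^♭`** (p431050's claim-def `SameValueGroup`,
false at this typed structure: `p^√2` is a value of `𝔾`, not of `ℂ_p^♭`). Calibration of the TYPING (the typed Def. 4.1.1 admits
non-untilts), not a statement about the preprint's Prop. 4.1.7, whose untilts ARE untilts of `F` (§3.6); under E-t10's ONTO
tilt-monoid datum the clause is a theorem (p433682) and `𝔾` is excluded (§1). Located, not adjudicated. [folklore] -/
theorem not_sameValueGroup_gaussIrrOverPadicTilt (b : A.BasePt (Untilt.gaussIrr p) (embGaussIrr p X)) :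
    letI := normedFieldTilt (Untilt.padicComplex p)
    haveI := completeSpace_tilt (Untilt.padicComplex p)
    haveI := isUltrametricDist_tilt (Untilt.padicComplex p)
    haveI := isAlgClosed_normedFieldTilt (Untilt.padicComplex p)
    haveI := charP_normedFieldTilt (Untilt.padicComplex p)
    ¬ (gaussIrrOverPadicTilt X A b).SameValueGroup := fun h =>
  range_norm_gaussIrr_ne_padicComplex p ((sameValueGroup_ofIsometricEmbedding_iff _ _ _ _ _ _ _ b).1 h)

/-- … while «the same cardinality as that of F» HOLDS there (E-t10's unconditional `ArithHolStructure.sameCardinality`; here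
`#𝔾 = 𝔠 = #ℂ_p^♭`): of the typed Prop. 4.1.7 (1) invariants it is the VALUE GROUP — i.e. the tilt up to isometry — that the typed
datum fails to pin. [folklore] -/
theorem sameCardinality_gaussIrrOverPadicTilt (b : A.BasePt (Untilt.gaussIrr p) (embGaussIrr p X)) :
    letI := normedFieldTilt (Untilt.padicComplex p)
    haveI := completeSpace_tilt (Untilt.padicComplex p)
    haveI := isUltrametricDist_tilt (Untilt.padicComplex p)
    haveI := isAlgClosed_normedFieldTilt (Untilt.padicComplex p)
    haveI := charP_normedFieldTilt (Untilt.padicComplex p)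
    (gaussIrrOverPadicTilt X A b).SameCardinality :=
  letI := normedFieldTilt (Untilt.padicComplex p)
  haveI := completeSpace_tilt (Untilt.padicComplex p)
  haveI := isUltrametricDist_tilt (Untilt.padicComplex p)
  haveI := isAlgClosed_normedFieldTilt (Untilt.padicComplex p)
  haveI := charP_normedFieldTilt (Untilt.padicComplex p)
  ArithHolStructure.sameCardinality _

/-- **The typed `tiltIso : 𝔾♭ ≃+* ℂ_p♭` of this structure is NOT an isometry** (indeed NO field isomorphism `𝔾♭ ≃+* ℂ_p♭` is,
part 1 `not_exists_isometric_ringEquiv_tilt`; here via E-t10's `sameValueGroup_of_tiltIso_isometry`): print's «with an isometry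
K♭ ≃ F» ([J-I] §3.5) is exactly the clause the typed field iso does not carry. [folklore] -/
theorem not_isometry_tiltIso_gaussIrrOverPadicTilt (b : A.BasePt (Untilt.gaussIrr p) (embGaussIrr p X)) :
    letI := normedFieldTilt (Untilt.padicComplex p)
    haveI := completeSpace_tilt (Untilt.padicComplex p)
    haveI := isUltrametricDist_tilt (Untilt.padicComplex p)
    haveI := isAlgClosed_normedFieldTilt (Untilt.padicComplex p)
    haveI := charP_normedFieldTilt (Untilt.padicComplex p)
    ¬ ∀ y : tilt (Untilt.gaussIrr p),
      ‖(gaussIrrOverPadicTilt X A b).tiltIso y‖ = (letI := normedFieldTilt (Untilt.gaussIrr p); ‖y‖) :=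
  not_isometry_tiltIso_ofIsometricEmbedding _ _ _ _ (norm_padicToGaussIrr p) _ (continuous_embGaussIrr p X) b
    (range_norm_gaussIrr_ne_padicComplex p)

/-- **The untilt of a TYPED arithmetic holomorphic structure over `F` need not be an untilt of `F`**: over `F = ℂ_p^♭` there is
(modulo a base point) a structure whose untilt carries NO tilt-monoid datum over `F` (§1). The typed tilt datum of p431050
(`tiltIso` abstract + `sharp` isometric INTO `K`) is WEAKER than print's «(K ⊃ E, K♭ ≃ F) … with an isometry K♭ ≃ F» exactly by
E-t10's ONTO condition `TiltMonoidDatum.flat_surj`. [folklore] -/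
theorem exists_arithHolStructure_without_tiltMonoidDatum (b : A.BasePt (Untilt.gaussIrr p) (embGaussIrr p X)) :
    letI := normedFieldTilt (Untilt.padicComplex p)
    haveI := completeSpace_tilt (Untilt.padicComplex p)
    haveI := isUltrametricDist_tilt (Untilt.padicComplex p)
    haveI := isAlgClosed_normedFieldTilt (Untilt.padicComplex p)
    haveI := charP_normedFieldTilt (Untilt.padicComplex p)
    ∃ S : ArithHolStructure X A (tilt (Untilt.padicComplex p)), IsEmpty (TiltMonoidDatum S.U (tilt (Untilt.padicComplex p))) :=
  ⟨gaussIrrOverPadicTilt X A b, isEmpty_tiltMonoidDatum_gaussIrr_padicTilt p⟩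

/-- **Prop. 4.1.7 (1)'s value-group clause is NOT a consequence of the typed Def. 4.1.1** over `F = ℂ_p^♭` (given a base point for
`𝔾`): `¬ ∀ S, S.SameValueGroup`. Compare E-t10's `sameValueGroup_of_tiltMonoidDatum` (the clause under the ONTO datum) and
`ofTilt_sameValueGroup_sameResidueField` (the clause at the genuine structure `K` over `K♭`). [folklore] -/
theorem not_forall_sameValueGroup_padicTilt (b : A.BasePt (Untilt.gaussIrr p) (embGaussIrr p X)) :
    letI := normedFieldTilt (Untilt.padicComplex p)
    haveI := completeSpace_tilt (Untilt.padicComplex p)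
    haveI := isUltrametricDist_tilt (Untilt.padicComplex p)
    haveI := isAlgClosed_normedFieldTilt (Untilt.padicComplex p)
    haveI := charP_normedFieldTilt (Untilt.padicComplex p)
    ¬ ∀ S : ArithHolStructure X A (tilt (Untilt.padicComplex p)), S.SameValueGroup :=
  fun h => not_sameValueGroup_gaussIrrOverPadicTilt X A b (h _)

/-- **`NeedNotBeTopIso X A (ℂ_p^♭)` IS INHABITED AS TYPED** (Prop. 4.1.7 (2) «if F = ℂ_p^♭, then K₁, K₂ need not even be
topologically isomorphic», p431050's claim-def; E-t10 15:08Z «no cheap door»), modulo base points for `ℂ_p` and `𝔾`: the genuine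
structure `ℂ_p` over `ℂ_p^♭` (E-t10's `ofTilt`) and `𝔾` over `ℂ_p^♭` (above), with `¬ ℂ_p.TopIso 𝔾` (p448902). CAVEAT: inhabited for
a NON-[KedlayaTemkin2018] reason — `𝔾` is not an untilt of `ℂ_p^♭` (§1); what is witnessed is the TYPED sentence, whose structure
does not force `K` to be an untilt of `F`. Our kernel check of the typed clause; no endorsement. [claim: Joshi2021ATS1, status: disputed] -/
theorem needNotBeTopIso_padicTilt (b₁ : A.BasePt (Untilt.padicComplex p) (ATSObj.embPadicComplex X))
    (b₂ : A.BasePt (Untilt.gaussIrr p) (embGaussIrr p X)) :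
    letI := normedFieldTilt (Untilt.padicComplex p)
    haveI := completeSpace_tilt (Untilt.padicComplex p)
    haveI := isUltrametricDist_tilt (Untilt.padicComplex p)
    haveI := isAlgClosed_normedFieldTilt (Untilt.padicComplex p)
    haveI := charP_normedFieldTilt (Untilt.padicComplex p)
    NeedNotBeTopIso X A (tilt (Untilt.padicComplex p)) :=
  ⟨ArithHolStructure.ofTilt (Untilt.padicComplex p) (ATSObj.embPadicComplex X) (ATSObj.continuous_embPadicComplex X) b₁,
    gaussIrrOverPadicTilt X A b₂, Untilt.not_topIso_padicComplex_gaussIrr p⟩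

/-- **`ExistsNonIso X A (ℂ_p^♭)` IS INHABITED AS TYPED** (Prop. 4.1.7 (2) «There exist arithmetic holomorphic structures … which
are not isomorphic»), by E-t10's `existsNonIso_of_needNotBeTopIso`; same caveat. [claim: Joshi2021ATS1, status: disputed] -/
theorem existsNonIso_padicTilt (b₁ : A.BasePt (Untilt.padicComplex p) (ATSObj.embPadicComplex X))
    (b₂ : A.BasePt (Untilt.gaussIrr p) (embGaussIrr p X)) :
    letI := normedFieldTilt (Untilt.padicComplex p)
    haveI := completeSpace_tilt (Untilt.padicComplex p)
    haveI := isUltrametricDist_tilt (Untilt.padicComplex p)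
    haveI := isAlgClosed_normedFieldTilt (Untilt.padicComplex p)
    haveI := charP_normedFieldTilt (Untilt.padicComplex p)
    ExistsNonIso X A (tilt (Untilt.padicComplex p)) :=
  letI := normedFieldTilt (Untilt.padicComplex p)
  haveI := completeSpace_tilt (Untilt.padicComplex p)
  haveI := isUltrametricDist_tilt (Untilt.padicComplex p)
  haveI := isAlgClosed_normedFieldTilt (Untilt.padicComplex p)
  haveI := charP_normedFieldTilt (Untilt.padicComplex p)
  existsNonIso_of_needNotBeTopIso (needNotBeTopIso_padicTilt X A b₁ b₂)

end GaussUntilt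

end Summit.ABC.IUTFork.Joshi

end
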